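import Summits.HodgeConjecture.CorCM.AndreProductFormBiproduct
import Literature.AlgebraicGeometry.HodgeTheory.HodgeClassesIsogenyInvariance
import HarnessLib

/-!
# COR-CM — the induced slot `A → E^h`: pull-backs along the projections span `H¹(A)`, with non-zero eigen-coordinates

HONEST FRAMING (cell `pub-hodgecm2` / COR-CM, seat b24 gen 9; COUNT-NEUTRAL — no binder row of
`HOME/BINDER-OWNERS.md` is touched; nothing about algebraic cycles is asserted).  Companion of
`CorCM/CyclicSexticInducedCornerCurve.lean` / `CyclicSexticFaceWeilType.lean` (A1-BLUEPRINT step L3, the `E`-side of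
the pull-back step L5): those files provide, for a realisation `(A, ι, θ)` of a type of `K` induced from the type
`Φ₀` of a subfield `i : k → K`, a CM elliptic curve `E ⊨ (k; Φ₀)`, a product `P` of copies of `E` with projections
`π_m` (`IsLimit (Fan.mk P π)`), and an ISOGENY `g : A ⟶ P` intertwining the `𝓞_k`-actions
(`ι(i a) ≫ (g ≫ π_m) = (g ≫ π_m) ≫ ι_E(a)`).  Here, for such data (no induced-type hypothesis is needed):

* `exists_eq_sum_map_of_isLimit_fan` — `H¹(P) = Σ_m π_m^* H¹(E)` (the fan is a biproduct in the preadditive category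
  of abelian varieties: `Bicone.ofLimitCone`, `IsBilimit.total`, additivity of `H¹`-pull-back);
* `mem_span_map_comp_of_isogeny_fan` — hence every class of `H¹(A)` is a sum `Σ_m (g ≫ π_m)^* y_m` (`g^*` is
  bijective, `complexBetti_map_bijective_of_isIsogeny`);
* `repr_eq_zero_of_eigen` — a joint eigenvector of the `𝓞_k`-action on `H¹(A)` for the character `τ′` has zero
  coordinate on every `K`-eigenline `v_s` with `s ∘ i ≠ τ′`;
* `exists_repr_map_comp_ne_zero` — **for every `s : K → ℂ` some `ν_m := g ≫ π_m` pulls the `(s ∘ i)`-eigenline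
  `u_{s∘i}` of `E` to a class with NON-ZERO `s`-coordinate** in the eigenbasis `v` of `H¹(A)` (else the coordinate
  form `v^*_s` would vanish on all `ν_m^* u_τ`, which together span `H¹(A)`).
This is the `E`-factor of the monomial-matrix determinant in the pull-back computation of L5.

THEOREMS ONLY; no `sorry`; axioms `propext`, `Classical.choice`, `Quot.sound`.

## References
* [Shimura1998] G. Shimura, *Abelian Varieties with Complex Multiplication and Modular Functions* (1998), §6.2
  Thm. 3 (the isogeny `A → B^h` for an induced type).
* [LangeBirkenhake1992] H. Lange, Ch. Birkenhake, *Complex Abelian Varieties* (1992), §1.1 (p. 19) (`H¹` of a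
  product; additivity of the rational representation).
-/

noncomputable section

namespace Summit.HodgeConjecture.CorCM.CMCurvePower

open CategoryTheory CategoryTheory.Limits NumberField
open Literature.AlgebraicGeometry Literature.AlgebraicGeometry.Motives Literature.AlgebraicGeometry.HodgeTheory
open Literature.AlgebraicGeometry.ComplexMultiplication (IsCMTypeRealisation)
open Literature.NumberTheory.Automorphic.PicardCM (eigenline)
open Summit.HodgeConjecture.HodgeConjecture.Theorems.HodgeAbelianVarieties.CMPivotAndre
  (complexBetti_map_map_one_apply complexBetti_map_id_one_apply complexBetti_map_finsetSum_one)
open Summit.HodgeConjecture.CorCM.AndreProductForm (map_ι_apply_of_mem_eigenline)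

/-! ## §1 `H¹` of a fan-product and of an isogenous variety -/

section Fan

variable {A P E : AbelianVariety ℂ} {h : ℕ} (π : Fin h → (P ⟶ E))

/-- **`H¹(P) = Σ_m π_m^* H¹(E)` for a product `P = ∏_{m<h} E` given as a limit fan**: in the preadditive category of
abelian varieties the fan is a biproduct (`Bicone.ofLimitCone`, `biconeIsBilimitOfLimitConeOfIsLimit`), so
`𝟙_P = Σ_m π_m ≫ ι_m` (`IsBilimit.total`) and, pulling back additively on `H¹` (`complexBetti_map_finsetSum_one`),
`x = Σ_m π_m^* (ι_m^* x)`. [cite: LangeBirkenhake1992, §1.1 (p. 19)] -/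
theorem exists_eq_sum_map_of_isLimit_fan (hlim : IsLimit (Fan.mk P π)) (x : complexBetti P.X 1) :
    ∃ y : Fin h → complexBetti E.X 1, x = ∑ m, complexBetti.map (π m).hom.hom.hom 1 (y m) := by
  classical
  let b : Bicone (fun _ : Fin h => E) := Bicone.ofLimitCone hlim
  have hb : b.IsBilimit := biconeIsBilimitOfLimitConeOfIsLimit hlim
  -- the sections of the fan, typed over `P`
  let ιP : Fin h → (E ⟶ P) := fun m => b.ι m
  have htot : ∑ m, π m ≫ ιP m = 𝟙 P := IsBilimit.total hb
  refine ⟨fun m => complexBetti.map (ιP m).hom.hom.hom 1 x, ?_⟩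
  have h1 : complexBetti.map (∑ m, π m ≫ ιP m).hom.hom.hom 1 x = x := by
    rw [htot]; exact complexBetti_map_id_one_apply x
  have h2 : complexBetti.map (∑ m, π m ≫ ιP m).hom.hom.hom 1 x =
      ∑ m, complexBetti.map (π m ≫ ιP m).hom.hom.hom 1 x :=
    Literature.AlgebraicGeometry.Pohlmann1968.complexBetti_map_sum_one_apply Finset.univ (fun m => π m ≫ ιP m) x
  conv_lhs => rw [← h1, h2]
  exact Finset.sum_congr rfl fun m _ => (complexBetti_map_map_one_apply (π m) (ιP m) x).symm

/-- **Every class of `H¹(A)` is a sum of pull-backs `Σ_m (g ≫ π_m)^* y_m`** for an ISOGENY `g : A ⟶ P` onto a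
fan-product `P = ∏_{m<h} E`: `g^*` is surjective on `H¹` (`complexBetti_map_bijective_of_isIsogeny`) and
`H¹(P) = Σ_m π_m^* H¹(E)`. [cite: Shimura1998, §6.2 Theorem 3] [cite: LangeBirkenhake1992, §1.1 (p. 19)] -/
theorem exists_eq_sum_map_comp_of_isogeny_fan (hlim : IsLimit (Fan.mk P π)) {g : A ⟶ P}
    (hg : AbelianVariety.IsIsogeny g) (z : complexBetti A.X 1) :
    ∃ y : Fin h → complexBetti E.X 1, z = ∑ m, complexBetti.map (g ≫ π m).hom.hom.hom 1 (y m) := by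
  obtain ⟨x, rfl⟩ := (complexBetti_map_bijective_of_isIsogeny hg 1).2 z
  obtain ⟨y, rfl⟩ := exists_eq_sum_map_of_isLimit_fan π hlim x
  refine ⟨y, ?_⟩
  rw [map_sum]
  exact Finset.sum_congr rfl fun m _ => complexBetti_map_map_one_apply g (π m) (y m)

end Fan

/-! ## §2 Eigen-coordinates -/

section Eigen

variable {K : Type} [Field K] [NumberField K] {k : Type} [Field k] [NumberField k]

/-- Two ring maps `k → ℂ` that agree on `𝓞_k` are equal (`𝓞_k` contains a `ℚ`-basis of `k`). [folklore] -/
theorem ringHom_eq_of_eqOn_integers {f g : k →+* ℂ} (h : ∀ a : 𝓞 k, f a = g a) : f = g := by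
  have hL : f.toRatAlgHom.toLinearMap = g.toRatAlgHom.toLinearMap := by
    refine (integralBasis k).ext fun i => ?_
    simp only [AlgHom.toLinearMap_apply, RingHom.toRatAlgHom_apply, integralBasis_apply]
    exact h _
  exact RingHom.ext fun x => LinearMap.congr_fun hL x

/-- **Zero coordinates of a joint `𝓞_k`-eigenvector.**  Let `(A, ι, θ)` realise a CM type of `K`, with eigenbasis
`v` of `H¹(A)` (`v_s` in the `s`-eigenline), and `i : k → K`.  If `x ∈ H¹(A)` satisfies
`ι(i a)^* x = τ′(a) · x` for all `a ∈ 𝓞_k`, then its coordinate on `v_s` vanishes for every `s` with `s ∘ i ≠ τ′`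
(`ι(i a)^*` is diagonal on `v` with entries `s(i a)`, and `s ∘ i ≠ τ′` already on `𝓞_k`). [folklore] -/
theorem repr_eq_zero_of_eigen (i : k →+* K) {Ψ : CMType K} {A : AbelianVariety ℂ} {ι : 𝓞 K →+* End A}
    {θ : K →+* Module.End ℂ (complexBetti A.X 1)} (hA : IsCMTypeRealisation Ψ A ι θ)
    (v : Module.Basis (K →+* ℂ) ℂ (complexBetti A.X 1)) (hv : ∀ s, v s ∈ eigenline θ s)
    {τ' : k →+* ℂ} {x : complexBetti A.X 1}
    (hx : ∀ a : 𝓞 k, complexBetti.map (ι (RingOfIntegers.mapRingHom i a)).hom.hom.hom 1 x = τ' (a : k) • x)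
    {s : K →+* ℂ} (hs : s.comp i ≠ τ') : v.repr x s = 0 := by
  classical
  -- some `a ∈ 𝓞_k` separates `s ∘ i` from `τ′`
  obtain ⟨a, ha⟩ : ∃ a : 𝓞 k, s (i (a : k)) ≠ τ' (a : k) := by
    by_contra! hall
    exact hs (ringHom_eq_of_eqOn_integers fun a => by simpa using hall a)
  -- the `s`-coordinate of `ι(i a)^* x` computed two ways
  have hdiag : ∀ t, complexBetti.map (ι (RingOfIntegers.mapRingHom i a)).hom.hom.hom 1 (v t) =
      t (i (a : k)) • v t := by
    intro t
    rw [map_ι_apply_of_mem_eigenline hA (hv t), RingOfIntegers.mapRingHom_apply]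
  have hT : ∀ y : complexBetti A.X 1,
      v.repr (complexBetti.map (ι (RingOfIntegers.mapRingHom i a)).hom.hom.hom 1 y) s = s (i (a : k)) * v.repr y s := by
    intro y
    conv_lhs => rw [← v.sum_repr y]
    rw [map_sum, map_sum]
    simp only [map_smul, hdiag, Finsupp.coe_finsetSum, Finset.sum_apply, Finsupp.coe_smul, Pi.smul_apply,
      Module.Basis.repr_self, Finsupp.single_apply, smul_eq_mul]
    rw [Finset.sum_eq_single s (fun t _ hts => by rw [if_neg hts, mul_zero, mul_zero])
      (fun hs' => absurd (Finset.mem_univ s) hs')]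
    rw [if_pos rfl, mul_one, mul_comm]
  have h1 := hT x
  rw [hx a, map_smul, Finsupp.coe_smul, Pi.smul_apply, smul_eq_mul] at h1
  have h2 : (s (i (a : k)) - τ' (a : k)) * v.repr x s = 0 := by rw [sub_mul, ← h1, sub_self]
  rcases mul_eq_zero.mp h2 with h3 | h3
  · exact absurd (sub_eq_zero.mp h3) ha
  · exact h3

/-- **Non-zero eigen-coordinates of the pull-backs `ν_m^* u_τ`** (the `E`-side of A1-BLUEPRINT step L5).  Let
`(A, ι, θ)` realise a CM type `Ψ` of `K` (eigenbasis `v`), `(E, ι_E, θ_E)` a CM type `Φ₀` of `k` (eigenbasis `u`),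
`i : k → K`, `P = ∏_{m<h} E` a limit fan with projections `π_m`, and `g : A ⟶ P` an ISOGENY intertwining the
`𝓞_k`-actions (`ι(i a) ≫ ν_m = ν_m ≫ ι_E(a)`, `ν_m := g ≫ π_m` — the output of Shimura's Thm. 3,
`Shimura1998_Thm3_isogenousPower` / `CyclicSextic.exists_inducedType_cmCurve_isogeny_of_sq_stable`).  Then for every
`s : K → ℂ` some `ν_m^* u_{s∘i}` has NON-ZERO `s`-coordinate: the classes `ν_m^* u_τ` (`m < h`, `τ : k → ℂ`) span
`H¹(A)` (`exists_eq_sum_map_comp_of_isogeny_fan`), `ν_m^* u_τ` is a joint `𝓞_k`-eigenvector for `τ`, so for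
`τ ≠ s ∘ i` its `s`-coordinate is `0` (`repr_eq_zero_of_eigen`); if also all `ν_m^* u_{s∘i}` had zero `s`-coordinate,
the coordinate form `v^*_s` would vanish identically, contradicting `v^*_s(v_s) = 1`.
[cite: Shimura1998, §6.2 Theorem 3] -/
theorem exists_repr_map_comp_ne_zero (i : k →+* K)
    {Ψ : CMType K} {A : AbelianVariety ℂ} {ι : 𝓞 K →+* End A} {θ : K →+* Module.End ℂ (complexBetti A.X 1)}
    (hA : IsCMTypeRealisation Ψ A ι θ)
    (v : Module.Basis (K →+* ℂ) ℂ (complexBetti A.X 1)) (hv : ∀ s, v s ∈ eigenline θ s)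
    {Φ₀ : CMType k} {E : AbelianVariety ℂ} {ιE : 𝓞 k →+* End E} {θE : k →+* Module.End ℂ (complexBetti E.X 1)}
    (hE : IsCMTypeRealisation Φ₀ E ιE θE)
    (u : Module.Basis (k →+* ℂ) ℂ (complexBetti E.X 1)) (hu : ∀ τ, u τ ∈ eigenline θE τ)
    {h : ℕ} {P : AbelianVariety ℂ} (π : Fin h → (P ⟶ E)) (hlim : Nonempty (IsLimit (Fan.mk P π)))
    {g : A ⟶ P} (hg : AbelianVariety.IsIsogeny g)
    (hcomm : ∀ (m : Fin h) (a : 𝓞 k), ι (RingOfIntegers.mapRingHom i a) ≫ (g ≫ π m) = (g ≫ π m) ≫ ιE a)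
    (s : K →+* ℂ) :
    ∃ m : Fin h, v.repr (complexBetti.map (g ≫ π m).hom.hom.hom 1 (u (s.comp i))) s ≠ 0 := by
  classical
  obtain ⟨hlim⟩ := hlim
  by_contra! hall
  -- the `ν_m^* u_τ` are joint eigenvectors for `τ`
  have heig : ∀ (m : Fin h) (τ : k →+* ℂ) (a : 𝓞 k),
      complexBetti.map (ι (RingOfIntegers.mapRingHom i a)).hom.hom.hom 1
          (complexBetti.map (g ≫ π m).hom.hom.hom 1 (u τ)) =
        τ (a : k) • complexBetti.map (g ≫ π m).hom.hom.hom 1 (u τ) := by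
    intro m τ a
    rw [complexBetti_map_map_one_apply, hcomm m a, ← complexBetti_map_map_one_apply,
      map_ι_apply_of_mem_eigenline hE (hu τ) a, map_smul]
  -- hence ALL `ν_m^* u_τ` have zero `s`-coordinate
  have hzero : ∀ (m : Fin h) (τ : k →+* ℂ), v.repr (complexBetti.map (g ≫ π m).hom.hom.hom 1 (u τ)) s = 0 := by
    intro m τ
    by_cases hτ : s.comp i = τ
    · rw [← hτ]; exact hall m
    · exact repr_eq_zero_of_eigen i hA v hv (heig m τ) hτ
  -- but they span `H¹(A)`, and `v^*_s (v_s) = 1`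
  obtain ⟨y, hy⟩ := exists_eq_sum_map_comp_of_isogeny_fan π hlim hg (v s)
  have h1 : v.repr (v s) s = 0 := by
    rw [hy, map_sum, Finsupp.coe_finsetSum, Finset.sum_apply]
    refine Finset.sum_eq_zero fun m _ => ?_
    rw [← u.sum_repr (y m), map_sum, map_sum, Finsupp.coe_finsetSum, Finset.sum_apply]
    refine Finset.sum_eq_zero fun τ _ => ?_
    rw [map_smul, map_smul, Finsupp.coe_smul, Pi.smul_apply, hzero m τ, smul_zero]
  rw [v.repr_self, Finsupp.single_eq_same] at h1
  exact one_ne_zero h1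

end Eigen

end Summit.HodgeConjecture.CorCM.CMCurvePower

end
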